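import Literature.NumberTheory.Sieve.PolynomialValuesSieveSequence
import HarnessLib

/-!
# Prime values of a polynomial: the sieve decomposition by the least prime factor

Topic `Literature/NumberTheory/Sieve`, companion of `PolynomialValuesSieveSequence.lean`. The
combinatorial skeleton of Granville–Mollin's (6.1) (*Rabinowitsch revisited*, Acta Arith. 96
(2000), §6A: "if `f(n)` is composite for `n ≤ N`, with `N ≫ A`, then there exists a prime `q ≪ N`
for which `q` divides `f(n)`. Therefore, by the fundamental lemma of the sieve, if `y = N^{o(1)}`
then, for `m = ∏_{p ≤ y} p`, we have
`π_f(N) = #{n ≤ N : (f(n), m) = 1} + O(∑_{y < q ≤ N} #{n ≤ N : q ∣ f(n) and (f(n), m) = 1})`"),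
general in `f ∈ ℤ[X]` and PROVED (no sieve input; the estimates of the two terms are
`PolynomialValuesSieveBounds.lean`). With `P(y) = primesProdBelow y = ∏_{p<y} p` and
`v_n = |f(n)|`:

* `card_prime_le_card_coprime_add` — `#{n ≤ N : v_n prime} ≤ #{n ≤ N : (v_n, P(y)) = 1} +
  #{n ≤ N : v_n < y}` (a prime value not coprime to `P(y)` is a prime `< y`).
* `card_coprime_le_card_prime_add_sum` — if `2 ≤ v_n ≤ Q²` on `(0, N]`, then
  `#{n ≤ N : (v_n, P(y)) = 1} ≤ #{n ≤ N : v_n prime} + ∑_{y ≤ q ≤ Q, q prime} #{n ≤ N : q ∣ f(n),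
  (v_n, P(y)) = 1}` (classify a composite rough value by its least prime factor `q`, `q² ≤ v_n`).
* `card_dvd_coprime_eq_sum_apIndex` — `#{n ≤ N : q ∣ f(n), (v_n, P(y)) = 1} =
  ∑_{r mod q, q ∣ f(r)} #{n ∈ apIndex N q r : (v_n, P(y)) = 1}` (the `ω_f(q)` progressions).
* `card_natAbs_lt_le_sqrt` — if `f(n) ≥ n²` then `#{n ≤ N : v_n < y} ≤ √y`.
* `polyPrimeCount_single_le_card_add_one`, `card_le_polyPrimeCount_single` — the tree's
  `polyPrimeCount ![f] N` (which counts `n = 0, 1, …, N`) and `#{1 ≤ n ≤ N : v_n prime}` differ by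
  at most the term `n = 0`, when `f > 0` on `ℕ`.

[cite: GranvilleMollin2000, §6A (6.1)] [folklore]
-/

noncomputable section

open Finset Polynomial

namespace Literature.NumberTheory.Sieve

variable (f : ℤ[X])

/-- **Prime values are rough or small**: `#{1 ≤ n ≤ N : |f(n)| prime} ≤
#{1 ≤ n ≤ N : (|f(n)|, P(y)) = 1} + #{1 ≤ n ≤ N : |f(n)| < y}`. [cite: GranvilleMollin2000, §6A (6.1)] -/
theorem card_prime_le_card_coprime_add (N : ℕ) (y : ℝ) :
    #((Ioc 0 N).filter fun n : ℕ => (f.eval (n : ℤ)).natAbs.Prime) ≤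
      #((Ioc 0 N).filter fun n : ℕ => (f.eval (n : ℤ)).natAbs.Coprime (primesProdBelow y)) +
        #((Ioc 0 N).filter fun n : ℕ => (((f.eval (n : ℤ)).natAbs : ℕ) : ℝ) < y) := by
  refine le_trans (Finset.card_le_card fun n hn => ?_) (Finset.card_union_le _ _)
  rw [Finset.mem_filter] at hn
  rw [Finset.mem_union, Finset.mem_filter, Finset.mem_filter]
  by_cases hc : (f.eval (n : ℤ)).natAbs.Coprime (primesProdBelow y)
  · exact Or.inl ⟨hn.1, hc⟩
  · refine Or.inr ⟨hn.1, ?_⟩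
    have hdvd : (f.eval (n : ℤ)).natAbs ∣ primesProdBelow y := by
      by_contra h
      exact hc ((Nat.Prime.coprime_iff_not_dvd hn.2).mpr h)
    exact (dvd_primesProdBelow_iff hn.2 y).mp hdvd

/-- **Rough values are prime or have a least prime factor `q ∈ [y, Q]`** (the `O`-term of (6.1)):
if `2 ≤ |f(n)| ≤ Q²` for `1 ≤ n ≤ N` and `Q ≥ 0`, then
`#{n : (|f(n)|, P(y)) = 1} ≤ #{n : |f(n)| prime} + ∑_{q prime, ⌈y⌉ ≤ q ≤ ⌊Q⌋} #{n : q ∣ f(n), (|f(n)|, P(y)) = 1}`.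
[cite: GranvilleMollin2000, §6A (6.1)] -/
theorem card_coprime_le_card_prime_add_sum (N : ℕ) {y Q : ℝ} (hQ : 0 ≤ Q)
    (hval : ∀ n ∈ Ioc 0 N, 2 ≤ (f.eval (n : ℤ)).natAbs ∧ (((f.eval (n : ℤ)).natAbs : ℕ) : ℝ) ≤ Q ^ 2) :
    #((Ioc 0 N).filter fun n : ℕ => (f.eval (n : ℤ)).natAbs.Coprime (primesProdBelow y)) ≤
      #((Ioc 0 N).filter fun n : ℕ => (f.eval (n : ℤ)).natAbs.Prime) +
        ∑ q ∈ (Nat.primesLE ⌊Q⌋₊).filter (fun q => ⌈y⌉₊ ≤ q),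
          #((Ioc 0 N).filter fun n : ℕ =>
            (q : ℤ) ∣ f.eval (n : ℤ) ∧ (f.eval (n : ℤ)).natAbs.Coprime (primesProdBelow y)) := by
  classical
  set T := (Nat.primesLE ⌊Q⌋₊).filter (fun q => ⌈y⌉₊ ≤ q) with hT
  set C : ℕ → Finset ℕ := fun q => (Ioc 0 N).filter fun n : ℕ =>
    (q : ℤ) ∣ f.eval (n : ℤ) ∧ (f.eval (n : ℤ)).natAbs.Coprime (primesProdBelow y) with hC
  have hcover : (Ioc 0 N).filter (fun n : ℕ => (f.eval (n : ℤ)).natAbs.Coprime (primesProdBelow y)) ⊆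
      (Ioc 0 N).filter (fun n : ℕ => (f.eval (n : ℤ)).natAbs.Prime) ∪ T.biUnion C := by
    intro n hn
    rw [Finset.mem_filter] at hn
    obtain ⟨hnI, hcop⟩ := hn
    rw [Finset.mem_union, Finset.mem_filter, Finset.mem_biUnion]
    by_cases hpr : (f.eval (n : ℤ)).natAbs.Prime
    · exact Or.inl ⟨hnI, hpr⟩
    · right
      set v := (f.eval (n : ℤ)).natAbs with hv
      obtain ⟨hv2, hvQ⟩ := hval n hnI
      have hv1 : v ≠ 1 := by omega
      have hv0 : 0 < v := by omega
      set q := v.minFac with hq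
      have hqp : q.Prime := Nat.minFac_prime hv1
      have hqv : q ∣ v := Nat.minFac_dvd v
      have hq2 : q ^ 2 ≤ v := Nat.minFac_sq_le_self hv0 hpr
      refine ⟨q, ?_, ?_⟩
      · rw [hT, Finset.mem_filter, Nat.mem_primesLE]
        refine ⟨⟨Nat.le_floor ?_, hqp⟩, ?_⟩
        · have h1 : ((q : ℕ) : ℝ) ^ 2 ≤ Q ^ 2 := by
            have : ((q ^ 2 : ℕ) : ℝ) ≤ (v : ℝ) := by exact_mod_cast hq2
            push_cast at this
            linarith
          exact (pow_le_pow_iff_left₀ (Nat.cast_nonneg _) hQ two_ne_zero).mp h1 |> fun h => h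
        · by_contra hlt
          have hqy : q < ⌈y⌉₊ := Nat.lt_of_not_le hlt
          have hmem : q ∈ Nat.primesBelow ⌈y⌉₊ := Nat.mem_primesBelow.mpr ⟨hqy, hqp⟩
          exact (coprime_primesProdBelow_iff v y).mp hcop q hmem hqv
      · rw [hC, Finset.mem_filter]
        exact ⟨hnI, Int.natCast_dvd.mpr hqv, hcop⟩
  calc #((Ioc 0 N).filter fun n : ℕ => (f.eval (n : ℤ)).natAbs.Coprime (primesProdBelow y))
      ≤ #((Ioc 0 N).filter (fun n : ℕ => (f.eval (n : ℤ)).natAbs.Prime) ∪ T.biUnion C) :=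
        Finset.card_le_card hcover
    _ ≤ #((Ioc 0 N).filter fun n : ℕ => (f.eval (n : ℤ)).natAbs.Prime) + #(T.biUnion C) :=
        Finset.card_union_le _ _
    _ ≤ #((Ioc 0 N).filter fun n : ℕ => (f.eval (n : ℤ)).natAbs.Prime) + ∑ q ∈ T, #(C q) :=
        add_le_add le_rfl Finset.card_biUnion_le

/-- **The progressions of a prime divisor**: for `q ≥ 1`,
`#{1 ≤ n ≤ N : q ∣ f(n), (|f(n)|, P(y)) = 1} = ∑_{0 ≤ r < q, q ∣ f(r)} #{n ∈ apIndex N q r : (|f(n)|, P(y)) = 1}`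
(at most `ω_f(q)` progressions). [cite: GranvilleMollin2000, §6A (6.1)] -/
theorem card_dvd_coprime_eq_sum_apIndex (N : ℕ) {q : ℕ} (hq : 0 < q) (y : ℝ) :
    #((Ioc 0 N).filter fun n : ℕ =>
        (q : ℤ) ∣ f.eval (n : ℤ) ∧ (f.eval (n : ℤ)).natAbs.Coprime (primesProdBelow y)) =
      ∑ r ∈ (range q).filter (fun r : ℕ => (q : ℤ) ∣ f.eval (r : ℤ)),
        #((apIndex N q r).filter fun n : ℕ => (f.eval (n : ℤ)).natAbs.Coprime (primesProdBelow y)) := by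
  have hset : (Ioc 0 N).filter (fun n : ℕ =>
      (q : ℤ) ∣ f.eval (n : ℤ) ∧ (f.eval (n : ℤ)).natAbs.Coprime (primesProdBelow y)) =
      ((Ioc 0 N).filter (fun n : ℕ => (f.eval (n : ℤ)).natAbs.Coprime (primesProdBelow y))).filter
        (fun n : ℕ => (q : ℤ) ∣ f.eval (n : ℤ)) := by
    rw [Finset.filter_filter]
    exact Finset.filter_congr fun n _ => and_comm
  rw [hset, card_filter_dvd_eval_eq_sum f _ hq]
  refine Finset.sum_congr rfl fun r _ => ?_
  congr 1
  unfold apIndex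
  rw [Finset.filter_filter, Finset.filter_filter]
  exact Finset.filter_congr fun n _ => and_comm

/-- **Small values**: if `f(n) ≥ n²` for all `n`, then `#{1 ≤ n ≤ N : |f(n)| < y} ≤ √y`.
[folklore] -/
theorem card_natAbs_lt_le_sqrt (N : ℕ) (y : ℝ) (hf : ∀ n : ℕ, ((n : ℤ)) ^ 2 ≤ f.eval (n : ℤ)) :
    (#((Ioc 0 N).filter fun n : ℕ => (((f.eval (n : ℤ)).natAbs : ℕ) : ℝ) < y) : ℝ) ≤ Real.sqrt y := by
  have hsub : (Ioc 0 N).filter (fun n : ℕ => (((f.eval (n : ℤ)).natAbs : ℕ) : ℝ) < y) ⊆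
      Ioc 0 ⌊Real.sqrt y⌋₊ := by
    intro n hn
    rw [Finset.mem_filter, Finset.mem_Ioc] at hn
    rw [Finset.mem_Ioc]
    refine ⟨hn.1.1, Nat.le_floor ?_⟩
    have h1 : ((n : ℕ) : ℝ) ^ 2 ≤ (((f.eval (n : ℤ)).natAbs : ℕ) : ℝ) := by
      have h0 : (0 : ℤ) ≤ f.eval (n : ℤ) := le_trans (sq_nonneg _) (hf n)
      have h2 : ((n : ℤ)) ^ 2 ≤ ((f.eval (n : ℤ)).natAbs : ℤ) := by
        rw [Int.natAbs_of_nonneg h0]; exact hf n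
      exact_mod_cast h2
    have hy : ((n : ℕ) : ℝ) ^ 2 < y := lt_of_le_of_lt h1 hn.2
    rw [← Real.sqrt_sq (Nat.cast_nonneg n)]
    exact Real.sqrt_le_sqrt hy.le
  calc (#((Ioc 0 N).filter fun n : ℕ => (((f.eval (n : ℤ)).natAbs : ℕ) : ℝ) < y) : ℝ)
      ≤ #(Ioc 0 ⌊Real.sqrt y⌋₊) := by exact_mod_cast Finset.card_le_card hsub
    _ = ⌊Real.sqrt y⌋₊ := by rw [Nat.card_Ioc, Nat.sub_zero]
    _ ≤ Real.sqrt y := Nat.floor_le (Real.sqrt_nonneg y)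

/-- For `f > 0` on `ℕ`, the tree's `polyPrimeCount ![f] N` is `#{0 ≤ n ≤ N : |f(n)| prime}`.
[folklore] -/
theorem polyPrimeCount_single_eq_card (hpos : ∀ n : ℕ, 0 < f.eval (n : ℤ)) (N : ℕ) :
    polyPrimeCount ![f] N = #((range (N + 1)).filter fun n : ℕ => (f.eval (n : ℤ)).natAbs.Prime) := by
  unfold polyPrimeCount
  refine congrArg Finset.card ?_
  ext n
  simp only [Finset.mem_filter, Finset.mem_range, Fin.forall_fin_one, Matrix.cons_val_zero,
    and_congr_right_iff]
  intro _
  have h0 := hpos n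
  have hnat : (f.eval (n : ℤ)).toNat = (f.eval (n : ℤ)).natAbs := by
    have h1 : (((f.eval (n : ℤ)).toNat : ℕ) : ℤ) = (((f.eval (n : ℤ)).natAbs : ℕ) : ℤ) := by
      rw [Int.toNat_of_nonneg h0.le, Int.natAbs_of_nonneg h0.le]
    exact_mod_cast h1
  rw [hnat]
  exact ⟨fun h => h.2, fun h => ⟨h0, h⟩⟩

/-- `polyPrimeCount ![f] N ≤ #{1 ≤ n ≤ N : |f(n)| prime} + 1` for `f > 0` on `ℕ` (the extra term
is `n = 0`). [folklore] -/
theorem polyPrimeCount_single_le_card_add_one (hpos : ∀ n : ℕ, 0 < f.eval (n : ℤ)) (N : ℕ) :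
    polyPrimeCount ![f] N ≤ #((Ioc 0 N).filter fun n : ℕ => (f.eval (n : ℤ)).natAbs.Prime) + 1 := by
  rw [polyPrimeCount_single_eq_card f hpos]
  have hsub : (range (N + 1)).filter (fun n : ℕ => (f.eval (n : ℤ)).natAbs.Prime) ⊆
      insert 0 ((Ioc 0 N).filter fun n : ℕ => (f.eval (n : ℤ)).natAbs.Prime) := by
    intro n hn
    rw [Finset.mem_filter, Finset.mem_range] at hn
    rw [Finset.mem_insert, Finset.mem_filter, Finset.mem_Ioc]
    rcases Nat.eq_zero_or_pos n with rfl | hn0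
    · exact Or.inl rfl
    · exact Or.inr ⟨⟨hn0, Nat.lt_succ_iff.mp hn.1⟩, hn.2⟩
  exact (Finset.card_le_card hsub).trans (Finset.card_insert_le _ _)

/-- `#{1 ≤ n ≤ N : |f(n)| prime} ≤ polyPrimeCount ![f] N` for `f > 0` on `ℕ`. [folklore] -/
theorem card_le_polyPrimeCount_single (hpos : ∀ n : ℕ, 0 < f.eval (n : ℤ)) (N : ℕ) :
    #((Ioc 0 N).filter fun n : ℕ => (f.eval (n : ℤ)).natAbs.Prime) ≤ polyPrimeCount ![f] N := by
  rw [polyPrimeCount_single_eq_card f hpos]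
  refine Finset.card_le_card fun n hn => ?_
  rw [Finset.mem_filter, Finset.mem_Ioc] at hn
  rw [Finset.mem_filter, Finset.mem_range]
  exact ⟨Nat.lt_succ_of_le hn.1.2, hn.2⟩

end Literature.NumberTheory.Sieve
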